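import Summits.KontsevichZagierPeriods.KontsevichZagierPeriods.Theorems.LinRedNormalFormHoffmanIndependenceLevelOne
import Summits.KontsevichZagierPeriods.KontsevichZagierPeriods.Theorems.LinRedNormalFormHoffmanIndependenceRescaling

/-!
# Crux `HoffmanIndependence` (stmt-KontsevichZagierPeriods-15045), line `weight_split` —
# the DEPTH-ONE SHADOW of the crux: `1, ζ(3), ζ(5), ζ(7), …` over `ℚ[π²]` and `ℚ(π²)`

Assembly of two landed cycle-3 stubs of the line (`stub_levelOne_iff`, level-one typing, p140900;
`stub_linearIndependent_mul_pow_iff` / `linearIndependent_mul_pow_iff_intermediateField`,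
transcendental rescaling, p140683) into the classical statement they were registered for:

* `levelOne_iff_oddZetas_linearIndependent_adjoin` — the level-`≤ 1` slice of the crux (the Hoffman
  words with at most one letter `3`, an infinite sub-family across all weights) is `ℚ`-linearly
  independent **iff** `1, ζ(3), ζ(5), ζ(7), …` are linearly independent over the ring
  `ℚ[π²] = Algebra.adjoin ℚ {π²}`; `levelOne_iff_oddZetas_linearIndependent_intermediateField` — iff
  they are linearly independent over the field `ℚ(π²) = IntermediateField.adjoin ℚ {π²}`;
* `oddZetas_linearIndependent_adjoin_of_hoffmanIndependence`,
  `oddZetas_linearIndependent_intermediateField_of_hoffmanIndependence` — hence the crux implies both;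
* `multipleZeta_odd_notMem_adjoin_pi_sq_of_hoffmanIndependence` — in particular the crux implies
  `ζ(2r+1) ∉ ℚ(π²)` for every `r ≥ 1` (no odd zeta value is a rational function of `π²`; open for
  every single `r`, already `ζ(3) ∉ ℚ + ℚπ²` is open); `multipleZeta_odd_ne_mul_of_hoffmanIndependence`
  — and `ζ(2r+1) ∉ ℚ(π²)·ζ(2s+1)` for `r ≠ s` (e.g. `ζ(5)/ζ(3) ∉ ℚ(π²)`, open).

So the depth-one content of `HoffmanIndependence` is exactly the folklore conjecture that
`π, ζ(3), ζ(5), …` satisfy no relation `P₀(π²) + ∑_{r ≥ 1} P_r(π²) ζ(2r+1) = 0` with rational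
polynomials `P_r` not all zero — weaker than their algebraic independence, stronger than the
irrationality of the `ζ(2r+1)/π^{2r+1}` — and the crux proves it through Zagier's `2-3-2` theorem and
Brown's invertible Zagier matrix (both tree theorems), with no motivic input.

No new definitions; this file supports the item, it does not close it.
[cite: Zagier2012, Theorem 1] [cite: Brown2012, Theorems 4.1, 7.3 and 7.4]
-/

noncomputable section

namespace Summit.KontsevichZagierPeriods.LinRedNormalForm.HoffmanIndependence

open Literature.NumberTheory.Transcendental MZV Real
open Summit.KontsevichZagierPeriods.KontsevichZagierPeriods.Theses.LinRedNormalForm (HoffmanIndependence)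

/-- The crux restricted to the level-`≤ 1` Hoffman words (a sub-family of an independent family is
independent). [folklore] -/
theorem levelOne_of_hoffmanIndependence (h : HoffmanIndependence) :
    LinearIndependent ℚ
      (fun u : {u : List ℕ // IsHoffman u ∧ u.count 3 ≤ 1} => multipleZeta u.1) := by
  have h' : LinearIndependent ℚ (fun u : {u : List ℕ // IsHoffman u} => multipleZeta u.1) := h
  exact h'.comp (fun u : {u : List ℕ // IsHoffman u ∧ u.count 3 ≤ 1} =>
      (⟨u.1, u.2.1⟩ : {u : List ℕ // IsHoffman u}))
    fun a b hab => Subtype.ext (by have h := congrArg Subtype.val hab; exact h)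

/-- **The level-one slice of the crux, in classical numbers (ring form).** The level-`≤ 1` Hoffman
values are `ℚ`-linearly independent iff `1, ζ(3), ζ(5), ζ(7), …` are linearly independent over the
ring `ℚ[π²] = Algebra.adjoin ℚ {π²}`: by the level-one typing (`stub_levelOne_iff`) the slice is the
`ℚ`-independence of `{π^{2m}} ∪ {π^{2m} ζ(2r+1)}`, i.e. of the products `(π²)^m · v_r` with `v₀ = 1`,
`v_r = ζ(2r+1)`, and `π²` is transcendental (`stub_linearIndependent_mul_pow_iff`).
[cite: Zagier2012, Theorem 1] [cite: Brown2012, Theorems 4.1 and 7.3] -/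
theorem levelOne_iff_oddZetas_linearIndependent_adjoin :
    LinearIndependent ℚ
        (fun u : {u : List ℕ // IsHoffman u ∧ u.count 3 ≤ 1} => multipleZeta u.1) ↔
      LinearIndependent (Algebra.adjoin ℚ ({Real.pi ^ 2} : Set ℝ))
        (fun r : ℕ => if r = 0 then (1 : ℝ) else multipleZeta [2 * r + 1]) := by
  have hπ2 : Transcendental ℚ (π ^ 2) := transcendental_pi_holds.pow two_pos
  rw [stub_levelOne_iff, ← stub_linearIndependent_mul_pow_iff hπ2]
  simp_rw [← pow_mul]

/-- **The level-one slice of the crux, in classical numbers (field form)**: iff `1, ζ(3), ζ(5), …`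
are linearly independent over the field `ℚ(π²) = IntermediateField.adjoin ℚ {π²}` (the fraction
field of `ℚ[π²]` inside `ℝ`; `linearIndependent_mul_pow_iff_intermediateField`).
[cite: Zagier2012, Theorem 1] [cite: Brown2012, Theorems 4.1 and 7.3] -/
theorem levelOne_iff_oddZetas_linearIndependent_intermediateField :
    LinearIndependent ℚ
        (fun u : {u : List ℕ // IsHoffman u ∧ u.count 3 ≤ 1} => multipleZeta u.1) ↔
      LinearIndependent (IntermediateField.adjoin ℚ ({π ^ 2} : Set ℝ))
        (fun r : ℕ => if r = 0 then (1 : ℝ) else multipleZeta [2 * r + 1]) := by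
  have hπ2 : Transcendental ℚ (π ^ 2) := transcendental_pi_holds.pow two_pos
  rw [stub_levelOne_iff, ← linearIndependent_mul_pow_iff_intermediateField hπ2]
  simp_rw [← pow_mul]

/-- **The depth-one shadow of the crux (ring form)**: `HoffmanIndependence` implies that
`1, ζ(3), ζ(5), ζ(7), …` are linearly independent over `ℚ[π²]` — no relation
`P₀(π²) + ∑_{r ≥ 1} P_r(π²) ζ(2r+1) = 0` with `P_r ∈ ℚ[X]` not all zero.
[cite: Zagier2012, Theorem 1] [cite: Brown2012, Theorem 4.1] -/
theorem oddZetas_linearIndependent_adjoin_of_hoffmanIndependence (h : HoffmanIndependence) :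
    LinearIndependent (Algebra.adjoin ℚ ({π ^ 2} : Set ℝ))
      (fun r : ℕ => if r = 0 then (1 : ℝ) else multipleZeta [2 * r + 1]) :=
  levelOne_iff_oddZetas_linearIndependent_adjoin.1 (levelOne_of_hoffmanIndependence h)

/-- **The depth-one shadow of the crux (field form)**: `HoffmanIndependence` implies that
`1, ζ(3), ζ(5), ζ(7), …` are linearly independent over the field `ℚ(π²)`.
[cite: Zagier2012, Theorem 1] [cite: Brown2012, Theorem 4.1] -/
theorem oddZetas_linearIndependent_intermediateField_of_hoffmanIndependence (h : HoffmanIndependence) :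
    LinearIndependent (IntermediateField.adjoin ℚ ({π ^ 2} : Set ℝ))
      (fun r : ℕ => if r = 0 then (1 : ℝ) else multipleZeta [2 * r + 1]) :=
  levelOne_iff_oddZetas_linearIndependent_intermediateField.1 (levelOne_of_hoffmanIndependence h)

/-- **Corollary: the crux implies `ζ(2r+1) ∉ ℚ(π²)` for every `r ≥ 1`** — no odd zeta value is a
rational function of `π²` with rational coefficients (open for every `r`; for `r = 1` it contains
the open `ζ(3) ∉ ℚ + ℚπ²`). A `ℚ(π²)`-multiple of `v₀ = 1` cannot be `v_r = ζ(2r+1)` in a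
`ℚ(π²)`-independent family. [cite: Zagier2012, Theorem 1] [cite: Brown2012, Theorem 4.1] -/
theorem multipleZeta_odd_notMem_adjoin_pi_sq_of_hoffmanIndependence (h : HoffmanIndependence)
    {r : ℕ} (hr : 1 ≤ r) :
    multipleZeta [2 * r + 1] ∉ IntermediateField.adjoin ℚ ({π ^ 2} : Set ℝ) := by
  intro hmem
  have hli := oddZetas_linearIndependent_intermediateField_of_hoffmanIndependence h
  have hr0 : r ≠ 0 := by omega
  have key := hli.notMem_span_image (s := ({0} : Set ℕ)) (x := r) (by simpa using hr0)
  apply key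
  rw [Set.image_singleton, Submodule.mem_span_singleton]
  refine ⟨⟨_, hmem⟩, ?_⟩
  rw [Algebra.smul_def, IntermediateField.algebraMap_apply]
  show multipleZeta [2 * r + 1] * (if (0 : ℕ) = 0 then (1 : ℝ) else multipleZeta [2 * 0 + 1]) =
    if r = 0 then (1 : ℝ) else multipleZeta [2 * r + 1]
  rw [if_pos rfl, if_neg hr0, mul_one]

/-- **Corollary: the crux implies that no ratio `ζ(2r+1)/ζ(2s+1)` (`r ≠ s`, both `≥ 1`) is a rational
function of `π²`**: for every `k ∈ ℚ(π²)`, `ζ(2r+1) ≠ k·ζ(2s+1)` (open for every pair; e.g.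
`ζ(5)/ζ(3) ∉ ℚ(π²)` contains the open irrationality of `ζ(5)/ζ(3)`).
[cite: Zagier2012, Theorem 1] [cite: Brown2012, Theorem 4.1] -/
theorem multipleZeta_odd_ne_mul_of_hoffmanIndependence (h : HoffmanIndependence) {r s : ℕ}
    (hr : 1 ≤ r) (hs : 1 ≤ s) (hrs : r ≠ s) {k : ℝ}
    (hk : k ∈ IntermediateField.adjoin ℚ ({π ^ 2} : Set ℝ)) :
    multipleZeta [2 * r + 1] ≠ k * multipleZeta [2 * s + 1] := by
  intro heq
  have hli := oddZetas_linearIndependent_intermediateField_of_hoffmanIndependence h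
  have hr0 : r ≠ 0 := by omega
  have hs0 : s ≠ 0 := by omega
  have key := hli.notMem_span_image (s := ({s} : Set ℕ)) (x := r) (by simpa using hrs)
  apply key
  rw [Set.image_singleton, Submodule.mem_span_singleton]
  refine ⟨⟨k, hk⟩, ?_⟩
  rw [Algebra.smul_def, IntermediateField.algebraMap_apply]
  show k * (if s = 0 then (1 : ℝ) else multipleZeta [2 * s + 1]) =
    if r = 0 then (1 : ℝ) else multipleZeta [2 * r + 1]
  rw [if_neg hs0, if_neg hr0]
  exact heq.symm

end Summit.KontsevichZagierPeriods.LinRedNormalForm.HoffmanIndependence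

end
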